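import Summits.NavierStokesRegularity.NavierStokesRegularity.Theses.QuantisedSymmetry
import Summits.NavierStokesRegularity.NavierStokesRegularity.Theses.Blowup
import Summits.NavierStokesRegularity.NavierStokesRegularity.Theses.DssFarFieldSlaving
import Summits.NavierStokesRegularity.NavierStokesRegularity.Theses.FilamentSkeletonRss
import Summits.NavierStokesRegularity.NavierStokesRegularity.Theorems.QuantisedSymmetryPolyhedralTruncationBridge
import Summits.NavierStokesRegularity.NavierStokesRegularity.Theorems.QuantisedSymmetryPolyhedralDssProfileExistsDominatesBlowupProfile
import Summits.NavierStokesRegularity.NavierStokesRegularity.Theorems.QuantisedSymmetryLiouvilleKillsProfile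
import Summits.NavierStokesRegularity.NavierStokesRegularity.Theorems.DssFarFieldSlavingDssTruncationBridge
import Summits.NavierStokesRegularity.NavierStokesRegularity.Theorems.FilamentSkeletonRssRdssProfileTruncation
import Summits.NavierStokesRegularity.NavierStokesRegularity.Theorems.LiouvilleConjectureNS
import HarnessLib

/-!
# Strategist census companion (family `s`, seat s21-g9) — crux `PolyhedralDssProfileExists`
# (stmt-NavierStokesRegularity-1404, route `QuantisedSymmetry`)

Sorry-free typed record behind `STRATEGY-CENSUS-s21.md`.  Nothing here is a line or a stub; every
`theorem` is proved from landed tree theorems, every `def` is a SIGNATURE the census discusses.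

§0  `crux_decides` — the crux ALONE refutes the summit (`¬ NavierStokesRegularity`) by landed theorems:
    the two co-hypotheses of the route's deciding theorem `closes` are proved
    (`quantisedSymmetry_polyhedralTruncationBridge_proof`, `ClayUniqueness_holds`).
§1  WEAKER-INTERMEDIATE LADDER (instruction step 1: "what strictly-weaker intermediate could replace
    the crux").  `C ⇒ W1 ⇒ W3 ⇒ ¬NSR` and `C ⇒ W2 ⇒ W3` are proved: every intermediate that can still
    stand in `closes` (W1 sector-free Type-I DSS profile, W2 rotated-DSS profile, W3 finite-time
    blow-up from a rapidly decaying datum) is itself summit-deciding by a landed bridge, so the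
    replacement has no leverage (and W1/W3 are other routes' cruxes: Blowup 0155 / X5a).
    `C ⇒ W5 ⇒ W4` is proved: W4 = failure of the KNSS Liouville conjecture (L), W5 = failure of the
    Type-I-decay Liouville statement; these ARE strictly weaker in the only usable sense — no tree
    theorem and no printed theorem turns W4 or W5 into `¬NSR` (a bounded ancient solution is not a
    blow-up) — so they cannot replace the crux in `closes`.
§2  DECOMPOSITION.  The 'certified construction' split `CapScheme ∧ (fixed-point theorem)` is typed
    and BOTH `CapScheme → C` and `C → CapScheme` are proved: as a Prop the scheme half is equivalent
    to the crux (singleton/constant scheme), i.e. the split is a costume unless the scheme is explicit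
    numerical DATA — which does not exist in any symmetry sector (census §Transfer/§Negation).
    The kill-switch side: `(L) ⇒ PolyhedralTypeILiouville` and `TypeIDecayLiouville ⇒
    PolyhedralTypeILiouville` are proved (dominating hypotheses of the NEGATION of the crux).
§3  STRENGTHEN.  Signatures `SelfSimilarProfileExists` (λ-continuous) and `NearOneProfiles`
    (λ ↓ 1 at fixed C₀): both are refuted in print / in tree (Tsai1998 = `tsai_selfsimilar_*_holds`,
    NRŠ1996; ChaeWolf2017 Thm 1.3 = `chaeWolf2017_removing_dss_holds`, Pineau–Vicol 2026 Thm 1.6),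
    recorded as defs only.
-/

set_option linter.dupNamespace false
set_option autoImplicit false

namespace Summit.NavierStokesRegularity.NavierStokesRegularity.Cruxes.PolyhedralDssProfileExists.StrategistS21g9

open MeasureTheory Set Filter
open Literature.Analysis.FluidPDE

/-- Shorthand for the crux. -/
abbrev C : Prop := Theses.QuantisedSymmetry.PolyhedralDssProfileExists

/-! ## §0 The crux decides the summit (negative side) unconditionally -/

/-- `PolyhedralDssProfileExists → ¬ NavierStokesRegularity` from the route's deciding theorem with its
two proved co-hypotheses. [folklore] -/
theorem crux_decides (hX : C) : ¬ _root_.NavierStokesRegularity :=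
  Theses.QuantisedSymmetry.closes hX Theorems.quantisedSymmetry_polyhedralTruncationBridge_proof
    Theses.QuantisedSymmetry.ClayUniqueness_holds

/-! ## §1 Weaker-intermediate ladder -/

/-- W1 — a sector-free Type-I (rotated) DSS profile exists (route `Blowup`, stmt-0155). -/
abbrev W1 : Prop := Theses.Blowup.BlowupTypeIDssProfile

/-- W2 — a nontrivial Type-I rotated-DSS ancient mild profile exists (antecedent of the landed
rotated truncation bridge `FilamentSkeletonRss.RdssProfileTruncation`). -/
def W2 : Prop :=
  ∃ (c : ℝ) (R : EuclideanSpace ℝ (Fin 3) ≃ₗᵢ[ℝ] EuclideanSpace ℝ (Fin 3))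
    (u : ℝ → EuclideanSpace ℝ (Fin 3) → EuclideanSpace ℝ (Fin 3)),
    1 < c ∧ IsAncientMildSolution 1 u ∧ (∀ t < 0, AEStronglyMeasurable (u t) volume) ∧
      IsRotatedDSS c R u ∧ (∃ C₀ : ℝ, HasTypeIDecay C₀ u) ∧ ¬ (∀ t < 0, u t =ᵐ[volume] 0)

/-- W3 — finite-time blow-up of a Leray–Hopf classical solution from a rapidly decaying datum
(route `Blowup`, X5a). -/
abbrev W3 : Prop := Theses.Blowup.BlowupExists

/-- W4 — the KNSS Liouville conjecture (L) fails. -/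
abbrev W4 : Prop := ¬ LiouvilleConjectureNS

/-- The Type-I-decay Liouville statement (Albritton–Barker's weak form of (L), sector-free):
bounded ancient mild solutions with measurable slices and `|u| ≤ C₀/(|x|+√−t)` vanish. -/
def TypeIDecayLiouville : Prop :=
  ∀ u : ℝ → EuclideanSpace ℝ (Fin 3) → EuclideanSpace ℝ (Fin 3), IsBoundedAncientMildSolution 1 u →
    (∀ t < 0, AEStronglyMeasurable (u t) volume) → (∃ C₀ : ℝ, HasTypeIDecay C₀ u) →
      ∀ t < 0, u t =ᵐ[volume] 0

/-- W5 — the Type-I-decay Liouville statement fails. -/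
abbrev W5 : Prop := ¬ TypeIDecayLiouville

/-- `C ⇒ W1` (landed registered stub of line `polyhedral_cell`). [folklore] -/
theorem crux_to_W1 : C → W1 :=
  Theorems.PolyhedralDssProfileExists.PolyhedralCell.stub_dominatesBlowupProfile

/-- `W1 ⇒ ¬NSR`: the sector-free profile is route `DssFarFieldSlaving`'s second hypothesis and its
truncation bridge is proved (`dssTruncationBridge_proof`). [folklore] -/
theorem W1_decides (h : W1) : ¬ _root_.NavierStokesRegularity :=
  Theses.DssFarFieldSlaving.closes Theorems.dssTruncationBridge_proof h

/-- `C ⇒ W2`: plain `λ`-DSS is rotated DSS with the trivial rotation. [folklore] -/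
theorem crux_to_W2 (hX : C) : W2 := by
  obtain ⟨G, -, -, -, c, hc, u, hanc, hmeas, hdss, hdec, -, hnt⟩ := hX
  exact ⟨c, LinearIsometryEquiv.refl ℝ (EuclideanSpace ℝ (Fin 3)), u, hc, hanc, hmeas,
    isRotatedDSS_refl_iff.mpr hdss, hdec, hnt⟩

/-- `W2 ⇒ W3` is the landed rotated truncation bridge. [folklore] -/
theorem W2_to_W3 (h : W2) : W3 :=
  Theorems.filamentSkeletonRss_rdssProfileTruncation_proof h

/-- `C ⇒ W3` (the route's own proved bridge). [folklore] -/
theorem crux_to_W3 (hX : C) : W3 := by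
  obtain ⟨G, hfin, hdet, hirr, c, hc, u, hanc, hmeas, hdss, hdec, heqv, hnt⟩ := hX
  exact Theorems.quantisedSymmetry_polyhedralTruncationBridge_proof G hfin hdet hirr c hc u hanc
    hmeas hdss hdec heqv hnt

/-- `W3 ⇒ ¬NSR` (route `Blowup`'s deciding theorem, X5b proved). [folklore] -/
theorem W3_decides (h : W3) : ¬ _root_.NavierStokesRegularity :=
  Theses.Blowup.closes h Theses.Blowup.BlowupClayUniqueness_holds

/-- Elementary: a slice that is a.e. a constant `b` and obeys the pointwise Type-I space–time decay
bound is a.e. zero (`b = 0`: outside a large ball the bound is `< ‖b‖`, and the exterior of a ball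
has positive Lebesgue measure). [folklore] -/
theorem const_eq_zero_of_typeIDecay {u : ℝ → EuclideanSpace ℝ (Fin 3) → EuclideanSpace ℝ (Fin 3)}
    {C₀ : ℝ} (hdec : HasTypeIDecay C₀ u) {t : ℝ} (ht : t < 0) {b : EuclideanSpace ℝ (Fin 3)}
    (hb : u t =ᵐ[volume] fun _ => b) : b = 0 := by
  by_contra hb0
  have hbpos : 0 < ‖b‖ := norm_pos_iff.mpr hb0
  have hstpos : 0 < Real.sqrt (-t) := Real.sqrt_pos.mpr (by linarith)
  set R : ℝ := max 0 (C₀ / ‖b‖) with hR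
  have hR0 : 0 ≤ R := le_max_left _ _
  -- outside the closed ball of radius `R` the slice cannot take the value `b`
  have hsub : (Metric.closedBall (0 : EuclideanSpace ℝ (Fin 3)) R)ᶜ ⊆ {x | u t x ≠ b} := by
    intro x hx hxb
    have hx' : R < ‖x‖ := by
      simpa [Metric.mem_closedBall, dist_zero_right] using hx
    have h1 : ‖u t x‖ ≤ C₀ / (‖x‖ + Real.sqrt (-t)) := hdec t ht x
    rw [hxb] at h1
    have hxpos : 0 < ‖x‖ + Real.sqrt (-t) := by positivity
    have h2 : C₀ / ‖b‖ < ‖x‖ := lt_of_le_of_lt (le_max_right _ _) hx'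
    have h3 : C₀ < ‖x‖ * ‖b‖ := (div_lt_iff₀ hbpos).mp h2
    have h4 : C₀ < ‖b‖ * (‖x‖ + Real.sqrt (-t)) := by nlinarith
    have h5 : C₀ / (‖x‖ + Real.sqrt (-t)) < ‖b‖ := (div_lt_iff₀ hxpos).mpr h4
    linarith
  have hnull : volume {x | u t x ≠ b} = 0 := by
    have h := hb
    rw [Filter.EventuallyEq, ae_iff] at h
    exact h
  have hnull' : volume ((Metric.closedBall (0 : EuclideanSpace ℝ (Fin 3)) R)ᶜ) = 0 :=
    measure_mono_null hsub hnull
  have hopen : IsOpen ((Metric.closedBall (0 : EuclideanSpace ℝ (Fin 3)) R)ᶜ) :=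
    Metric.isClosed_closedBall.isOpen_compl
  have hne : ((Metric.closedBall (0 : EuclideanSpace ℝ (Fin 3)) R)ᶜ).Nonempty := by
    obtain ⟨x, hx⟩ := NormedSpace.exists_lt_norm ℝ (EuclideanSpace ℝ (Fin 3)) R
    refine ⟨x, ?_⟩
    rw [Set.mem_compl_iff, Metric.mem_closedBall, dist_zero_right, not_le]
    exact hx
  exact (hopen.measure_pos volume hne).ne' hnull'

/-- `(L) ⇒ TypeIDecayLiouville` (dominating hypothesis of the kill side). [folklore] -/
theorem typeIDecayLiouville_of_L (hL : LiouvilleConjectureNS) : TypeIDecayLiouville := by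
  intro u hbam hmeas hdec t ht
  obtain ⟨C₀, hC₀⟩ := hdec
  obtain ⟨b, hb⟩ := hL u hbam hmeas t ht
  obtain rfl := const_eq_zero_of_typeIDecay hC₀ ht hb
  exact hb

/-- `TypeIDecayLiouville ⇒ PolyhedralTypeILiouville` (drop the symmetry). [folklore] -/
theorem polyhedralTypeILiouville_of_typeIDecayLiouville (h : TypeIDecayLiouville) :
    Theses.QuantisedSymmetry.PolyhedralTypeILiouville := by
  intro G _ _ _ u hbam hmeas hdec _ t ht
  exact h u hbam hmeas hdec t ht

/-- `(L) ⇒ PolyhedralTypeILiouville`. [folklore] -/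
theorem polyhedralTypeILiouville_of_L (hL : LiouvilleConjectureNS) :
    Theses.QuantisedSymmetry.PolyhedralTypeILiouville :=
  polyhedralTypeILiouville_of_typeIDecayLiouville (typeIDecayLiouville_of_L hL)

/-- `C ⇒ W5` via the landed kill-switch glue `LiouvilleKillsProfile`. [folklore] -/
theorem crux_to_W5 (hX : C) : W5 := fun h =>
  Theorems.quantisedSymmetry_liouvilleKillsProfile_proof
    (polyhedralTypeILiouville_of_typeIDecayLiouville h) hX

/-- `W5 ⇒ W4`. [folklore] -/
theorem W5_to_W4 (h : W5) : W4 := fun hL => h (typeIDecayLiouville_of_L hL)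

/-- `C ⇒ W4`. [folklore] -/
theorem crux_to_W4 (hX : C) : W4 := W5_to_W4 (crux_to_W5 hX)

/-! ## §2 Decomposition: the certified-construction split is a costume as a Prop -/

/-- `u` is a witness of the crux (the crux with the profile pulled out front). -/
def IsPolyhedralProfile (u : ℝ → EuclideanSpace ℝ (Fin 3) → EuclideanSpace ℝ (Fin 3)) : Prop :=
  ∃ G : Subgroup (EuclideanSpace ℝ (Fin 3) ≃ₗᵢ[ℝ] EuclideanSpace ℝ (Fin 3)), Finite G ∧
    (∀ g ∈ G, LinearMap.det (g.toLinearEquiv :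
      EuclideanSpace ℝ (Fin 3) →ₗ[ℝ] EuclideanSpace ℝ (Fin 3)) = 1) ∧
    (∀ V : Submodule ℝ (EuclideanSpace ℝ (Fin 3)), (∀ g ∈ G, ∀ v ∈ V, g v ∈ V) → V = ⊥ ∨ V = ⊤) ∧
    ∃ c : ℝ, 1 < c ∧ IsAncientMildSolution 1 u ∧ (∀ t < 0, AEStronglyMeasurable (u t) volume) ∧
      IsDiscretelySelfSimilar c u ∧ (∃ C₀ : ℝ, HasTypeIDecay C₀ u) ∧
      (∀ g ∈ G, ∀ t x, u t (g x) = g (u t x)) ∧ ¬ (∀ t < 0, u t =ᵐ[volume] 0)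

theorem crux_iff_exists_profile : C ↔ ∃ u, IsPolyhedralProfile u := by
  constructor
  · rintro ⟨G, hfin, hdet, hirr, c, hc, u, hanc, hmeas, hdss, hdec, heqv, hnt⟩
    exact ⟨u, G, hfin, hdet, hirr, c, hc, hanc, hmeas, hdss, hdec, heqv, hnt⟩
  · rintro ⟨u, G, hfin, hdet, hirr, c, hc, hanc, hmeas, hdss, hdec, heqv, hnt⟩
    exact ⟨G, hfin, hdet, hirr, c, hc, u, hanc, hmeas, hdss, hdec, heqv, hnt⟩

/-- D-a, the 'hard half' of a contraction-mapping / Newton–Kantorovich / computer-assisted split: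
SOME complete metric scheme with a contracting self-map whose fixed points read out as polyhedral
Type-I DSS profiles.  (The 'routine half' is Mathlib's `ContractingWith.fixedPoint`.) -/
def CapScheme : Prop :=
  ∃ (S : Type) (_ : MetricSpace S) (_ : CompleteSpace S) (_ : Nonempty S) (K : NNReal) (T : S → S)
    (Φ : S → (ℝ → EuclideanSpace ℝ (Fin 3) → EuclideanSpace ℝ (Fin 3))),
    ContractingWith K T ∧ ∀ s : S, T s = s → IsPolyhedralProfile (Φ s)

/-- Assembly of the split: scheme + Banach fixed point ⇒ crux. [folklore] -/
theorem crux_of_capScheme (h : CapScheme) : C := by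
  obtain ⟨S, _, _, _, K, T, Φ, hT, hread⟩ := h
  rw [crux_iff_exists_profile]
  exact ⟨Φ (ContractingWith.fixedPoint T hT), hread _ (ContractingWith.fixedPoint_isFixedPt hT)⟩

/-- … and the converse: the crux gives a (constant) scheme, so `CapScheme ↔ C` — the Prop-level
split carries no reduction; only explicit numerical data would. [folklore] -/
theorem capScheme_of_crux (hX : C) : CapScheme := by
  obtain ⟨u, hu⟩ := crux_iff_exists_profile.mp hX
  refine ⟨ℝ, inferInstance, inferInstance, inferInstance, 0, fun _ => 0, fun _ => u, ?_, fun _ _ => hu⟩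
  exact ⟨zero_lt_one, LipschitzWith.const (0 : ℝ)⟩

theorem capScheme_iff_crux : CapScheme ↔ C := ⟨crux_of_capScheme, capScheme_of_crux⟩

/-! ## §3 Strengthenings (signatures only; each is refuted in print / in tree, see census) -/

/-- S⁺₁: a λ-CONTINUOUS (self-similar for every factor) polyhedral Type-I profile — refuted
(NRŠ 1996; Tsai 1998 = `tsai_selfsimilar_bounded_holds` / `tsai_selfsimilar_local_energy_holds`). -/
def SelfSimilarProfileExists : Prop :=
  ∃ u : ℝ → EuclideanSpace ℝ (Fin 3) → EuclideanSpace ℝ (Fin 3), IsPolyhedralProfile u ∧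
    ∀ c : ℝ, 1 < c → IsDiscretelySelfSimilar c u

/-- S⁺₂: profiles with factor arbitrarily close to 1 at a FIXED Type-I constant — refuted by the
removal of near-1 DSS under the Type-I bound (Chae–Wolf 2017 Thm 1.3 = `chaeWolf2017_removing_dss`,
Pineau–Vicol 2026 Thm 1.6; tree N1 `…StubDilationWindow`). -/
def NearOneProfiles : Prop :=
  ∀ C₀ : ℝ, 0 < C₀ → ∀ c₁ : ℝ, 1 < c₁ → ∃ c : ℝ, 1 < c ∧ c < c₁ ∧
    ∃ u : ℝ → EuclideanSpace ℝ (Fin 3) → EuclideanSpace ℝ (Fin 3), IsPolyhedralProfile u ∧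
      IsDiscretelySelfSimilar c u ∧ HasTypeIDecay C₀ u

theorem selfSimilarProfileExists_to_crux (h : SelfSimilarProfileExists) : C :=
  crux_iff_exists_profile.mpr (h.imp fun _ hu => hu.1)

end Summit.NavierStokesRegularity.NavierStokesRegularity.Cruxes.PolyhedralDssProfileExists.StrategistS21g9
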